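import Summits.CriticalPhenomena.PercolationContinuityZ3.Theorems.PercNearOneGluingNoHeavyLowerTailMonoRhoReduction
import HarnessLib

/-!
# `NoHeavyLowerTail` (stmt-CriticalPhenomena-4575) — the MONO-ρ relay-deletion induction restricted to the
# LADDER CELLS `j + 3 ≤ |A| ≤ 2j + 1`, in dichotomy form ("CIL or the lossy step")

Support file (prover `prim-lf-5`; `--supports stmt-CriticalPhenomena-4575`), sharpening `…MonoRhoReduction.lean`.
No definitions, no named facts, no sorries.

Why this file.  `noHeavyLowerTail_of_monoRhoStep` asks for the lossy relay-deletion step at EVERY cell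
`|A| ≥ j + 3`.  That hypothesis is too strong: below the ladder the step is FALSE (exact census, crux evidence
LF5-CANDIDATES.md §A5: `(|A|, j) = (6, 2)`, the prism `C₃ × K₂` on the six relays with the observer weakly attached to
all of them loses the factor `1.39 > 6/5`).  But the telescoping induction for the crux level `j = ⌊|A|/2⌋` only ever
visits relay sets `B ⊆ A` with `j + 2 ≤ |B| ≤ |A| ≤ 2j + 1`, i.e. cells with `j ≥ ⌊|B|/2⌋` (at or above the ladder),
where the census finds no violation and the loss factor `|B|/(|B|−1)` is approached only from below.  So the
hypothesis is restricted here to `j + 3 ≤ |A| ≤ 2j + 1`, and weakened further to the dichotomy "some relay is a CIL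
witness for `A`, or the lossy step holds" (the induction runs with constant `|A|/(j+2) ≥ 1`, so a CIL witness is always
enough).  The registered stub `stub_monoRhoStepLadder` is exactly the hypothesis `hStep` below.

* `weakCIL_of_cilOrMonoRhoStepLadder` — `∃ a ∈ A, bad_j(A) ≤ (|A|/(j+2))·I_j(A; a)` for `j + 2 ≤ |A| ≤ 2j + 1`.
* `noHeavyLowerTail_of_cilOrMonoRhoStepLadder` — the crux (via `fatMinorityLinear_of_twoCIL`, `C = 4`).
* `noHeavyLowerTail_of_monoRhoStepLadder` — the plain (non-dichotomy) ladder-restricted step also closes the crux.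
-/

noncomputable section

namespace Summit.CriticalPhenomena.PercolationContinuityZ3.Theorems

open MeasureTheory Set Literature.Probability.LatticeModels Literature.Probability.Percolation
open scoped Classical BigOperators

variable {n : ℕ}

/-- **The telescoping induction on the ladder cells, dichotomy form.**  Hypothesis `hStep`: for every weighted graph,
relay set `A` with `j + 3 ≤ |A| ≤ 2j + 1`, observer `o ∉ A` and `c ≥ 0` such that every `A.erase y` satisfies
`bad_j ≤ c · I_j(A.erase y; a)` for some `a`, EITHER some `a ∈ A` has `bad_j(A) ≤ I_j(A; a)` (a CIL witness) OR some
`a ∈ A` has `bad_j(A) ≤ (|A|/(|A|−1))·c·I_j(A; a)` (the lossy relay-deletion step).  Conclusion: for `j ≥ 1` and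
`j + 2 ≤ |A| ≤ 2j + 1`, `o ∉ A`: `∃ a ∈ A, bad_j(A) ≤ (|A|/(j+2))·I_j(A; a)`.  Base `|A| = j + 2` is the landed level
`|A| − 2` (`cumulativeIsolation_level_card_sub_two`); the factors telescope. -/
theorem weakCIL_of_cilOrMonoRhoStepLadder
    (hStep : ∀ (j n : ℕ) (w : Sym2 (Fin n) → unitInterval) (A : Finset (Fin n)) (o : Fin n) (c : ℝ),
      o ∉ A → j + 3 ≤ A.card → A.card ≤ 2 * j + 1 → 0 ≤ c →
      (∀ y ∈ A, ∃ a ∈ A.erase y,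
        (prodBernoulli w).real {ω : BondConfig (Fin n) |
            1 ≤ ((A.erase y).filter fun x => ω ∈ openConn o x).card ∧
              ((A.erase y).filter fun x => ω ∈ openConn o x).card ≤ j} ≤
          c * (prodBernoulli w).real {ω : BondConfig (Fin n) |
            ((A.erase y).filter fun x => ω ∈ openConn a x).card ≤ j}) →
      (∃ a ∈ A,
        (prodBernoulli w).real {ω : BondConfig (Fin n) |
            1 ≤ (A.filter fun x => ω ∈ openConn o x).card ∧ (A.filter fun x => ω ∈ openConn o x).card ≤ j} ≤
          (prodBernoulli w).real {ω : BondConfig (Fin n) | (A.filter fun x => ω ∈ openConn a x).card ≤ j}) ∨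
      (∃ a ∈ A,
        (prodBernoulli w).real {ω : BondConfig (Fin n) |
            1 ≤ (A.filter fun x => ω ∈ openConn o x).card ∧ (A.filter fun x => ω ∈ openConn o x).card ≤ j} ≤
          (A.card : ℝ) / ((A.card : ℝ) - 1) * c *
            (prodBernoulli w).real {ω : BondConfig (Fin n) | (A.filter fun x => ω ∈ openConn a x).card ≤ j}))
    (j : ℕ) (hj : 1 ≤ j) :
    ∀ (m n : ℕ) (w : Sym2 (Fin n) → unitInterval) (A : Finset (Fin n)) (o : Fin n),
      o ∉ A → A.card = j + 2 + m → A.card ≤ 2 * j + 1 →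
      ∃ a ∈ A,
        (prodBernoulli w).real {ω : BondConfig (Fin n) |
            1 ≤ (A.filter fun x => ω ∈ openConn o x).card ∧ (A.filter fun x => ω ∈ openConn o x).card ≤ j} ≤
          ((A.card : ℝ) / ((j : ℝ) + 2)) *
            (prodBernoulli w).real {ω : BondConfig (Fin n) | (A.filter fun x => ω ∈ openConn a x).card ≤ j} := by
  intro m
  induction m with
  | zero =>
    intro n w A o _ hcard _
    have hk : 3 ≤ A.card := by omega
    obtain ⟨a, ha, hle⟩ := cumulativeIsolation_level_card_sub_two w A o hk
    refine ⟨a, ha, ?_⟩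
    have hsub : A.card - 2 = j := by omega
    rw [hsub] at hle
    have hcoef : (A.card : ℝ) / ((j : ℝ) + 2) = 1 := by
      rw [hcard, Nat.add_zero]
      push_cast
      exact div_self (by positivity)
    rw [hcoef, one_mul]
    exact hle
  | succ m ih =>
    intro n w A o ho hcard hlad
    have hk : j + 3 ≤ A.card := by omega
    set c : ℝ := ((j : ℝ) + 2 + m) / ((j : ℝ) + 2) with hc
    have hc0 : 0 ≤ c := by rw [hc]; positivity
    have hsub : ∀ y ∈ A, ∃ a ∈ A.erase y,
        (prodBernoulli w).real {ω : BondConfig (Fin n) |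
            1 ≤ ((A.erase y).filter fun x => ω ∈ openConn o x).card ∧
              ((A.erase y).filter fun x => ω ∈ openConn o x).card ≤ j} ≤
          c * (prodBernoulli w).real {ω : BondConfig (Fin n) |
            ((A.erase y).filter fun x => ω ∈ openConn a x).card ≤ j} := by
      intro y hy
      have hcard' : (A.erase y).card = j + 2 + m := by
        rw [Finset.card_erase_of_mem hy]; omega
      have hlad' : (A.erase y).card ≤ 2 * j + 1 := by omega
      have ho' : o ∉ A.erase y := fun h => ho (Finset.mem_of_mem_erase h)
      obtain ⟨a, ha, hle⟩ := ih n w (A.erase y) o ho' hcard' hlad'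
      refine ⟨a, ha, ?_⟩
      have hcoef : ((A.erase y).card : ℝ) / ((j : ℝ) + 2) = c := by
        rw [hcard', hc]; push_cast; ring
      rw [hcoef] at hle
      exact hle
    have hcoef1 : 1 ≤ (A.card : ℝ) / ((j : ℝ) + 2) := by
      rw [le_div_iff₀ (by positivity), one_mul]
      have : j + 2 ≤ A.card := by omega
      exact_mod_cast this
    rcases hStep j n w A o c ho hk hlad hc0 hsub with ⟨a, ha, hle⟩ | ⟨a, ha, hle⟩
    · refine ⟨a, ha, hle.trans ?_⟩
      have hnn : 0 ≤ (prodBernoulli w).real {ω : BondConfig (Fin n) | (A.filter fun x => ω ∈ openConn a x).card ≤ j} :=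
        measureReal_nonneg
      calc (prodBernoulli w).real {ω : BondConfig (Fin n) | (A.filter fun x => ω ∈ openConn a x).card ≤ j}
          = 1 * (prodBernoulli w).real {ω : BondConfig (Fin n) | (A.filter fun x => ω ∈ openConn a x).card ≤ j} :=
            (one_mul _).symm
        _ ≤ (A.card : ℝ) / ((j : ℝ) + 2) *
              (prodBernoulli w).real {ω : BondConfig (Fin n) | (A.filter fun x => ω ∈ openConn a x).card ≤ j} :=
            mul_le_mul_of_nonneg_right hcoef1 hnn
    · refine ⟨a, ha, hle.trans (le_of_eq ?_)⟩
      have hkm : (A.card : ℝ) - 1 = (j : ℝ) + 2 + m := by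
        rw [hcard]; push_cast; ring
      have hk1 : ((A.card : ℝ) - 1) ≠ 0 := by rw [hkm]; positivity
      rw [hc, ← hkm]
      field_simp

/-- **"CIL or MONO-ρ step" on the ladder cells closes the crux `NoHeavyLowerTail`** (two-CIL at the crux level from
`weakCIL_of_cilOrMonoRhoStepLadder` and `cumulativeIsolation_card_le_four`, then `fatMinorityLinear_of_twoCIL` with
`C = 4` and the landed `noHeavyLowerTail_of_fatMinorityLinear`).  The hypothesis is the registered stub
`stub_monoRhoStepLadder`. -/
theorem noHeavyLowerTail_of_cilOrMonoRhoStepLadder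
    (hStep : ∀ (j n : ℕ) (w : Sym2 (Fin n) → unitInterval) (A : Finset (Fin n)) (o : Fin n) (c : ℝ),
      o ∉ A → j + 3 ≤ A.card → A.card ≤ 2 * j + 1 → 0 ≤ c →
      (∀ y ∈ A, ∃ a ∈ A.erase y,
        (prodBernoulli w).real {ω : BondConfig (Fin n) |
            1 ≤ ((A.erase y).filter fun x => ω ∈ openConn o x).card ∧
              ((A.erase y).filter fun x => ω ∈ openConn o x).card ≤ j} ≤
          c * (prodBernoulli w).real {ω : BondConfig (Fin n) |
            ((A.erase y).filter fun x => ω ∈ openConn a x).card ≤ j}) →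
      (∃ a ∈ A,
        (prodBernoulli w).real {ω : BondConfig (Fin n) |
            1 ≤ (A.filter fun x => ω ∈ openConn o x).card ∧ (A.filter fun x => ω ∈ openConn o x).card ≤ j} ≤
          (prodBernoulli w).real {ω : BondConfig (Fin n) | (A.filter fun x => ω ∈ openConn a x).card ≤ j}) ∨
      (∃ a ∈ A,
        (prodBernoulli w).real {ω : BondConfig (Fin n) |
            1 ≤ (A.filter fun x => ω ∈ openConn o x).card ∧ (A.filter fun x => ω ∈ openConn o x).card ≤ j} ≤
          (A.card : ℝ) / ((A.card : ℝ) - 1) * c *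
            (prodBernoulli w).real {ω : BondConfig (Fin n) | (A.filter fun x => ω ∈ openConn a x).card ≤ j})) :
    Summit.CriticalPhenomena.PercolationContinuityZ3.Theses.PercNearOneGluing.NoHeavyLowerTail := by
  refine noHeavyLowerTail_of_fatMinorityLinear (fatMinorityLinear_of_twoCIL ?_)
  intro n w A o hA ho
  set j := A.card / 2 with hjdef
  have hevo : {ω : BondConfig (Fin n) |
      1 ≤ (A.filter fun x => ω ∈ openConn o x).card ∧ 2 * (A.filter fun x => ω ∈ openConn o x).card ≤ A.card} =
      {ω : BondConfig (Fin n) |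
        1 ≤ (A.filter fun x => ω ∈ openConn o x).card ∧ (A.filter fun x => ω ∈ openConn o x).card ≤ j} := by
    ext ω; simp only [Set.mem_setOf_eq]; omega
  have heva : ∀ a : Fin n, {ω : BondConfig (Fin n) | 2 * (A.filter fun x => ω ∈ openConn a x).card ≤ A.card} =
      {ω : BondConfig (Fin n) | (A.filter fun x => ω ∈ openConn a x).card ≤ j} := by
    intro a; ext ω; simp only [Set.mem_setOf_eq]; omega
  rcases Nat.lt_or_ge A.card 5 with h4 | h5
  · obtain ⟨a, ha, hle⟩ := cumulativeIsolation_card_le_four n w A o j (by omega) hA ho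
    refine ⟨a, ha, ?_⟩
    rw [hevo, heva a]
    have hnn : 0 ≤ (prodBernoulli w).real {ω : BondConfig (Fin n) | (A.filter fun x => ω ∈ openConn a x).card ≤ j} :=
      measureReal_nonneg
    linarith
  · have hj : 1 ≤ j := by omega
    have hm : A.card = j + 2 + (A.card - (j + 2)) := by omega
    have hlad : A.card ≤ 2 * j + 1 := by omega
    obtain ⟨a, ha, hle⟩ := weakCIL_of_cilOrMonoRhoStepLadder hStep j hj (A.card - (j + 2)) n w A o ho hm hlad
    refine ⟨a, ha, ?_⟩
    rw [hevo, heva a]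
    have hnn : 0 ≤ (prodBernoulli w).real {ω : BondConfig (Fin n) | (A.filter fun x => ω ∈ openConn a x).card ≤ j} :=
      measureReal_nonneg
    have hcoef : (A.card : ℝ) / ((j : ℝ) + 2) ≤ 2 := by
      have h2 : (A.card : ℝ) ≤ 2 * ((j : ℝ) + 2) := by
        have : A.card ≤ 2 * (j + 2) := by omega
        exact_mod_cast this
      rw [div_le_iff₀ (by positivity)]
      linarith
    exact hle.trans (mul_le_mul_of_nonneg_right hcoef hnn)

/-- **The plain lossy step on the ladder cells closes the crux.**  If for every weighted graph, relay set `A` with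
`j + 3 ≤ |A| ≤ 2j + 1`, observer `o ∉ A` and `c ≥ 0`, "every `A.erase y` satisfies `bad_j ≤ c·I_j(·; a)` for some `a`"
implies "some `a ∈ A` has `bad_j(A) ≤ (|A|/(|A|−1))·c·I_j(A; a)`", then `NoHeavyLowerTail` holds.  (The ratio form
MONO-ρ-DS of the crux evidence — `∃ y ∈ A, |A|·bad_j(A∖y)·max_a I_j(A;a) ≥ (|A|−1)·bad_j(A)·max_{a≠y} I_j(A∖y;a)` —
implies this outside the degenerate case `max_{a≠y} I_j(A∖y;a) = 0`; its census at the ladder cells (5,2), (6,3), (7,3),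
(7,4), (8,4), (8,5) has no violation.) -/
theorem noHeavyLowerTail_of_monoRhoStepLadder
    (hStep : ∀ (j n : ℕ) (w : Sym2 (Fin n) → unitInterval) (A : Finset (Fin n)) (o : Fin n) (c : ℝ),
      o ∉ A → j + 3 ≤ A.card → A.card ≤ 2 * j + 1 → 0 ≤ c →
      (∀ y ∈ A, ∃ a ∈ A.erase y,
        (prodBernoulli w).real {ω : BondConfig (Fin n) |
            1 ≤ ((A.erase y).filter fun x => ω ∈ openConn o x).card ∧
              ((A.erase y).filter fun x => ω ∈ openConn o x).card ≤ j} ≤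
          c * (prodBernoulli w).real {ω : BondConfig (Fin n) |
            ((A.erase y).filter fun x => ω ∈ openConn a x).card ≤ j}) →
      ∃ a ∈ A,
        (prodBernoulli w).real {ω : BondConfig (Fin n) |
            1 ≤ (A.filter fun x => ω ∈ openConn o x).card ∧ (A.filter fun x => ω ∈ openConn o x).card ≤ j} ≤
          (A.card : ℝ) / ((A.card : ℝ) - 1) * c *
            (prodBernoulli w).real {ω : BondConfig (Fin n) | (A.filter fun x => ω ∈ openConn a x).card ≤ j}) :
    Summit.CriticalPhenomena.PercolationContinuityZ3.Theses.PercNearOneGluing.NoHeavyLowerTail :=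
  noHeavyLowerTail_of_cilOrMonoRhoStepLadder fun j n w A o c ho hk hlad hc hsub =>
    Or.inr (hStep j n w A o c ho hk hlad hc hsub)

end Summit.CriticalPhenomena.PercolationContinuityZ3.Theorems

end
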